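/-
Copyright: cell `pub-ymgap` (HUMAN RULING D-0062), Track A, DAG node N21; seat `pub-ymgap-dag-n21-c` (generation 3), module 2.
-/
import Summits.QuantumFields.YangMills.Theorems.BalabanUVNodesN21LocalAveragedRegularity
import Literature.MathematicalPhysics.QuantumFieldTheory.Balaban1983to89.Node00.BackgroundActionOfRecord
import HarnessLib

/-!
# YM-DAG node N21 (= NE7c): [Balaban1985Averaging] PROPOSITION 2 (52)–(54) FOR THE (0.4) AVERAGING OF RECORD, UNIFORM IN THE NUMBER OF
# AVERAGINGS **AND LOCAL** — «it is enough to assume (52) for p ⊂ B^k(x) ∪ B^k(y) ∪ B^k(z) ∪ B^k(w)» (p. 26) — and the one-call END's γ3 reading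
# `hcore` in its BOX-LOCALISED species at NODE 00's minimiser of record

Track A of `YM-PLAN.md` (cell `pub-ymgap`, HUMAN RULING D-0062), node **N21** = spine estimate NE7c (`T4IndicatorShell.ShellWeightBound`, NOT PRINTED,
NOT PROVED).  Seat `pub-ymgap-dag-n21-c` (director-ym R134 row s1), generation 3, successor item S4a of the generation-2 HANDOFF, module 2 (module 1:
`…Theorems.BalabanUVNodesN21LocalAveragedRegularity`, the sharp LOCAL Prop. 1 `dist1_plaqHol_avgFun_le_sharp_of_boxRegion`).  Kernel theorems only:
0 `def`, 0 `sorry`, standard axioms; COUNT-NEUTRAL (`--supports stmt-QuantumFields-19908 --as helper`).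

THE PRINTED TEXT ([Balaban1985Averaging] p. 26, verbatim from the tree leaf `B7Prop1Local`): *«PROPOSITION 2. If U satisfies (52) with α₀ ≦ c₂ =
min{1/(3C₀), ½c₂′}, then |Ū^k(∂p) − 1| < α₀ + 2C₀α₀² < 2α₀, p ⊂ Ω^{(k)}. (54)  The result is local in the sense that if p = ⟨x, y, z, w⟩, then it is
enough to assume (52) for p ⊂ B^k(x) ∪ B^k(y) ∪ B^k(z) ∪ B^k(w).»*

WHAT THIS FILE PROVES (torus `T^{(i)} = Site P i` of `Setup`, the averaging of record `blockAvg expMeanLogSU` iterated from the finest lattice `T^{(0)}`,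
regions = seat `pub-ymgap-dag-n20-d`'s `N20LCSAvgDominationRegion.boxRegion x ρ` — the plaquettes cornered in the `ℓ^∞`-ball of radius `ρ` around `x`).
* §1 GEOMETRY of the nested boxes: `scaleCoord_intCast`, `mem_ball_emb_of_mem_ball` ∕ **`boxRegion_emb_subset`** (a fine box of radius `ρ` around
  the centre `emb z` of a block `z` within `m` of `x` lies in the fine box of radius `L·m + ρ` around `emb x`: `Site.emb_apply_eq`), `boxRegion_mono`,
  **`exists_embChain`** (every site `x` of `T^{(k)}` is the top of a chain of block centres `x_i = emb x_{i+1}` down to `T^{(0)}` — the inclusions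
  `T^{(i+1)} ⊂ T^{(i)}` have a different type at each level, so the iterated centre is carried as a chain).
* §2 **`plaqSmallOn_iter_blockAvg_eml_loc`** = PROPOSITION 2 LOCAL AND K-UNIFORM: along a chain of centres `xs` and radii `r` with
  `L·r(i+1) + (d+4)L + 2 ≤ r(i)`: if every plaquette of `boxRegion (xs 0) (r 0)` satisfies `|U(∂p) − 1| < α₀η²` (`η = L^{−k}`, (52) ON THE BOX ONLY),
  `C₀(d)α₀ ≤ ⅓`, `2α₀ ≤ c′₂`, then every plaquette of `boxRegion (xs k) (r k)` satisfies `|Ū^k(∂p) − 1| < α₀ + 2C₀(d)α₀²` ((54); the (53) induction is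
  `B7.prop2_of_ineq53` BY NAME on the level suprema over the boxes `exists_levelSupOn`; the step `dist1_plaqHol_avgFun_le_of_nested` is module 1's local
  sharp Prop. 1, the walk hull of radius `(d+4)L + 2` around each block centre of the smaller box lying in the bigger box by §1); `…_level` ((53) at every
  level, `B7.ineq53_induction`); **`…_pow`** (closed-form radii `L^{k−i}(m + c) − c`, `c = (d+4)L + 2`, `nested_radii_pow`: hypothesis on
  `boxRegion (xs 0) (L^k·(m + c))`, conclusion on `boxRegion (xs k) m`).
* §3 AT NODE 00 (`Node00.Uk ∕ UkExists ∕ iter_Uk`, `avOfRecord = blockAvg expMeanLogSU`): **`plaqSmallOn_datum_of_Uk_plaqSmallOn`** — THE ONE-CALL END's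
  γ3 READING `hcore` IN ITS BOX-LOCALISED SPECIES: on the solvable set, if the background of record `U_k(V)` is `θη_k²`-plaquette-small ON THE FINE BOX
  of radius `L^k(m + (d+4)L + 2)` around the bottom of a chain of block centres below `x`, then the datum `V = Ū^k(U_k(V))` is `2θ`-plaquette-small ON
  `boxRegion x m` (the local form of generation 2's `N21AveragedDatumRegularity.plaqSmall_datum_of_Uk_plaqSmall`); `plaqSmallOn_iter_avOfRecord_loc`,
  `plaqSmallOn_datum_of_isBackground_loc`.

HONEST FRAMING.  Locality radius: `(d+4)L + 2` fine steps per level around each block centre (the walk hull of the tree's crude local Stokes letters),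
cumulatively `≈ m + d + 6` blocks in the units of `T^{(k)}` (print: the four blocks of `p`).  The END's `hcore` is displayed by the one call
`ShellMeasureLiveEndOneCallUnionLevelsCfLinJunction` with schematic letters (`u`, `Pcore`, `boxPlaqs`); this file proves its SPECIES at NODE 00's objects,
NOT the literal hypothesis of p241094 (NODE O's dictionary).  Nothing of Bałaban's asserted; NE7c NOT PRINTED ∕ NOT PROVED; (M1) untouched; N21 NOT
discharged; typed 28∕28, count untouched; one finite torus at fixed `ε` — NOT ℝ⁴ ∕ infinite volume ∕ OS ∕ mass gap ∕ Clay.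
References: T. Bałaban, CMP 98 (1985) 17–51 [Balaban1985Averaging] (Prop. 2 p. 26); CMP 109 (1987) 249–301 [Balaban1987RG1] ((0.1)–(0.4), (0.21)).
-/

noncomputable section

open scoped BigOperators
namespace Summit.QuantumFields.YangMills.Theorems.N21LocalAveragedRegularity

open Literature.MathematicalPhysics.QuantumFieldTheory.Balaban1983to89
open T4Continuum BlockAveraging AveragingRT ExpMeanLog BlockAveragingEMLProp2
open Summit.QuantumFields.YangMills.BalabanUVNodes.N20LCSAvgDominationRegion (boxRegion mem_boxRegion mem_boxRegion_of_corner)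

variable {P : Params} {j : ℕ}

/-! ## §1 Geometry of the nested boxes across levels -/

section Geometry

/-- The cross-level scaling of an INTEGER label: `scaleCoord e = e·L` (`Site.natCast_mul_L_eq_of_modEq`). [cite: Balaban1987RG1, (0.1) p.251] -/
theorem scaleCoord_intCast (e : ℤ) :
    Site.scaleCoord P j ((e : ℤ) : ZMod (P.sitesPerDir (j + 1))) = ((e * (P.L : ℤ) : ℤ) : ZMod (P.sitesPerDir j)) := by
  have hnat : ∀ m : ℕ, Site.scaleCoord P j ((m : ℕ) : ZMod (P.sitesPerDir (j + 1))) = ((m * P.L : ℕ) : ZMod (P.sitesPerDir j)) := by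
    intro m
    rw [Site.scaleCoord_apply]
    apply Site.natCast_mul_L_eq_of_modEq
    rw [ZMod.val_natCast]
    exact Nat.mod_modEq m _
  obtain ⟨m, rfl | rfl⟩ := Int.eq_nat_or_neg e
  · rw [Int.cast_natCast, hnat]; push_cast; ring
  · rw [Int.cast_neg, Int.cast_natCast, map_neg, hnat]; push_cast; ring

/-- **A FINE BOX AROUND A NEARBY BLOCK CENTRE LIES IN A BIGGER FINE BOX**: `z` in the `ℓ^∞`-ball of radius `m` around `x` (coarse) and `w` in the
`ℓ^∞`-ball of radius `ρ` around `emb z` (fine) ⇒ `w` in the `ℓ^∞`-ball of radius `L·m + ρ` around `emb x` (`emb (x + e) = emb x + L·e`). [cite: Balaban1987RG1, (0.1)–(0.3) pp.251–252] -/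
theorem mem_ball_emb_of_mem_ball {x z : Site P (j + 1)} {m ρ : ℕ}
    (hz : ∀ ν, ∃ e : ℤ, |e| ≤ (m : ℤ) ∧ z ν = x ν + (e : ZMod (P.sitesPerDir (j + 1))))
    {w : Site P j} (hw : ∀ ν, ∃ e : ℤ, |e| ≤ (ρ : ℤ) ∧ w ν = (emb z) ν + (e : ZMod (P.sitesPerDir j))) :
    ∀ ν, ∃ e : ℤ, |e| ≤ ((P.L * m + ρ : ℕ) : ℤ) ∧ w ν = (emb x) ν + (e : ZMod (P.sitesPerDir j)) := by
  intro ν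
  obtain ⟨e₁, he₁, hz⟩ := hz ν
  obtain ⟨e₂, he₂, hw⟩ := hw ν
  refine ⟨e₁ * (P.L : ℤ) + e₂, ?_, ?_⟩
  · have hL0 : (0 : ℤ) ≤ (P.L : ℤ) := Int.natCast_nonneg _
    calc |e₁ * (P.L : ℤ) + e₂| ≤ |e₁ * (P.L : ℤ)| + |e₂| := abs_add_le _ _
      _ = |e₁| * (P.L : ℤ) + |e₂| := by rw [abs_mul, abs_of_nonneg hL0]
      _ ≤ (m : ℤ) * (P.L : ℤ) + (ρ : ℤ) := add_le_add (mul_le_mul_of_nonneg_right he₁ hL0) he₂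
      _ = ((P.L * m + ρ : ℕ) : ℤ) := by push_cast; ring
  · rw [hw, Site.emb_apply_eq, Site.emb_apply_eq, hz, map_add, scaleCoord_intCast]
    push_cast
    ring

/-- Box regions grow with the radius. [folklore] -/
theorem boxRegion_mono (x : Site P j) {ρ ρ' : ℕ} (h : ρ ≤ ρ') : boxRegion x ρ ⊆ boxRegion x ρ' := by
  intro q hq
  refine mem_boxRegion.mpr fun ν => ?_
  obtain ⟨e, he, hq⟩ := mem_boxRegion.mp hq ν
  exact ⟨e, he.trans (by exact_mod_cast h), hq⟩

/-- **THE BOX OF A NEARBY BLOCK CENTRE**: for `z` in the `ℓ^∞`-ball of radius `m` around `x` (coarse), `boxRegion (emb z) ρ ⊆ boxRegion (emb x) (L·m + ρ)`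
(fine). [cite: Balaban1987RG1, (0.1)–(0.3) pp.251–252] -/
theorem boxRegion_emb_subset {x z : Site P (j + 1)} {m ρ : ℕ}
    (hz : ∀ ν, ∃ e : ℤ, |e| ≤ (m : ℤ) ∧ z ν = x ν + (e : ZMod (P.sitesPerDir (j + 1)))) :
    boxRegion (emb z) ρ ⊆ boxRegion (emb x) (P.L * m + ρ) :=
  fun _ hq => mem_boxRegion.mpr (mem_ball_emb_of_mem_ball hz (mem_boxRegion.mp hq))

/-- **CHAINS OF BLOCK CENTRES**: every site `x` of `T^{(k)}` is the top `xs k = x` of a chain `xs i = emb (xs (i+1))` (`i < k`) down to the finest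
lattice — the iterated inclusion `T^{(k)} ⊂ T^{(k−1)} ⊂ ⋯ ⊂ T^{(0)}` of [Balaban1987RG1] (0.1), carried as a family because each level has its own type.
[cite: Balaban1987RG1, (0.1) p.251] -/
theorem exists_embChain : ∀ (k : ℕ) (x : Site P k),
    ∃ xs : (i : ℕ) → Site P i, xs k = x ∧ ∀ i < k, xs i = emb (xs (i + 1))
  | 0, x => by
    refine ⟨fun i => if h : i = 0 then cast (congrArg (Site P) h.symm) x else default, ?_, fun i hi => absurd hi (Nat.not_lt_zero i)⟩
    dsimp only
    rw [dif_pos rfl, cast_eq]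
  | k + 1, x => by
    obtain ⟨ys, hys, hch⟩ := exists_embChain k (emb x)
    refine ⟨fun i => if h : i = k + 1 then cast (congrArg (Site P) h.symm) x else ys i, ?_, fun i hi => ?_⟩
    · dsimp only
      rw [dif_pos rfl, cast_eq]
    · have hi1 : i ≠ k + 1 := by omega
      dsimp only
      rw [dif_neg hi1]
      by_cases hik : i = k
      · subst hik
        rw [dif_pos rfl, cast_eq]
        exact hys
      · have hi2 : i + 1 ≠ k + 1 := by omega
        rw [dif_neg hi2]
        exact hch i (by omega)

end Geometry

/-! ## §2 Proposition 2 (52)–(54) for (0.4), UNIFORM IN `k` AND LOCAL -/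

section Prop2

open scoped Matrix.Norms.L2Operator

variable {n : Type*} [Fintype n] [DecidableEq n] [Nonempty n]

/-- The level suprema `a_i = sup_{p ∈ S_i} |V_i(∂p)|` over finite plaquette sets (`0` on an empty set): every plaquette of `S_i` is below `a_i`, and
`a_i` is below any strict uniform bound on `S_i`. [cite: Balaban1985Averaging, (53) p.26] -/
theorem exists_levelSupOn (V : (i : ℕ) → GaugeField P i (Matrix.specialUnitaryGroup n ℂ)) (S : (i : ℕ) → Finset (Plaq P i)) :
    ∃ a : ℕ → ℝ, (∀ i, 0 ≤ a i) ∧ (∀ i, ∀ p ∈ S i, dist1 (GaugeField.plaqHol (V i) p) ≤ a i) ∧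
      ∀ i (B : ℝ), 0 < B → (∀ p ∈ S i, dist1 (GaugeField.plaqHol (V i) p) < B) → a i < B := by
  classical
  refine ⟨fun i => if h : (S i).Nonempty then (S i).sup' h (fun p => dist1 (GaugeField.plaqHol (V i) p)) else 0,
    fun i => ?_, fun i p hp => ?_, fun i B hB h => ?_⟩
  · dsimp only
    by_cases hne : (S i).Nonempty
    · rw [dif_pos hne]
      obtain ⟨q₀, -, hq₀⟩ := Finset.exists_mem_eq_sup' hne fun p => dist1 (GaugeField.plaqHol (V i) p)
      rw [hq₀]; exact GaugeGroup.dist1_nonneg _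
    · rw [dif_neg hne]
  · dsimp only
    have hne : (S i).Nonempty := ⟨p, hp⟩
    rw [dif_pos hne]
    exact Finset.le_sup' (fun p => dist1 (GaugeField.plaqHol (V i) p)) hp
  · dsimp only
    by_cases hne : (S i).Nonempty
    · rw [dif_pos hne]
      obtain ⟨q₀, hq₀S, hq₀⟩ := Finset.exists_mem_eq_sup' hne fun p => dist1 (GaugeField.plaqHol (V i) p)
      rw [hq₀]; exact h q₀ hq₀S
    · rw [dif_neg hne]; exact hB

/-- The second-order constant in the two currencies: `143·((((d+4)L)²/4)·a)² = C₀(d)·(L²a)²`, `C₀(d) = 143·((d+4)²/4)²`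
(as in `BlockAveragingEMLProp2`, private there). [folklore] -/
private theorem secondOrder_eq' (a : ℝ) :
    143 * (((((P.d + 4) * P.L : ℕ) : ℝ) ^ 2 / 4) * a) ^ 2 =
      (143 * ((((P.d + 4 : ℕ) : ℝ)) ^ 2 / 4) ^ 2) * ((P.L : ℝ) ^ 2 * a) ^ 2 := by
  push_cast; ring

/-- **THE INDUCTIVE STEP ON NESTED BOXES**: if `x = emb x′`, `L·ρ′ + (d+4)L + 2 ≤ ρ`, and every plaquette of `boxRegion x ρ` of the level-`i` field `W`
is within `a ≥ 0` of `1` with `(((d+4)L)²/4)·a ≤ δ_N/2`, then every plaquette of `boxRegion x′ ρ′` of `W̄` is within `L²a + C₀(d)(L²a)²` of `1` (module 1's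
local sharp Prop. 1; the walk hull around each block centre of the smaller box lies in the bigger box, §1). [cite: Balaban1985Averaging, (51) and (53) p.26] -/
theorem dist1_plaqHol_avgFun_le_of_nested {a : ℝ} (ha : 0 ≤ a) {i : ℕ} {W : GaugeField P i (Matrix.specialUnitaryGroup n ℂ)}
    (hs : ((((P.d + 4) * P.L : ℕ) : ℝ) ^ 2 / 4) * a ≤ deltaSU n / 2) {x : Site P i} {x' : Site P (i + 1)} (hx : x = emb x')
    {ρ ρ' : ℕ} (hρ : P.L * ρ' + ((P.d + 4) * P.L + 2) ≤ ρ)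
    (hW : ∀ q ∈ boxRegion x ρ, dist1 (GaugeField.plaqHol W q) ≤ a) {p : Plaq P (i + 1)} (hp : p ∈ boxRegion x' ρ') :
    dist1 (GaugeField.plaqHol (avgFun (expMeanLogSU (n := n)) W) p) ≤
      (P.L : ℝ) ^ 2 * a + (143 * ((((P.d + 4 : ℕ) : ℝ)) ^ 2 / 4) ^ 2) * ((P.L : ℝ) ^ 2 * a) ^ 2 := by
  rw [← secondOrder_eq']
  refine dist1_plaqHol_avgFun_le_sharp_of_boxRegion ha hs p fun q hq => hW q ?_
  rw [hx]
  exact boxRegion_mono _ hρ (boxRegion_emb_subset (mem_boxRegion.mp hp) hq)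

/-- **[Balaban1985Averaging] PROPOSITION 2 (52) ⇒ (54) FOR THE (0.4) AVERAGING OF RECORD, UNIFORM IN `k` AND LOCAL — PROVED.**  Let `xs` be a chain
of block centres (`xs i = emb (xs (i+1))`, `i < k`) and `r` radii with `L·r(i+1) + (d+4)L + 2 ≤ r(i)` (`i < k`).  If every plaquette of the fine box
`boxRegion (xs 0) (r 0)` satisfies `|U(∂p) − 1| < α₀η²` (`η = L^{−k}`; (52) ON THE BOX ONLY) with `0 < α₀`, `C₀(d)α₀ ≤ ⅓`, `2α₀ ≤ c′₂(d, L, N) =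
2δ_N/((d+4)L)²`, then every plaquette of `boxRegion (xs k) (r k)` satisfies `|Ū^k(∂p) − 1| < α₀ + 2C₀(d)α₀²` ((54), `C₀(d) = 143((d+4)²/4)²`).  The (53)
induction is the tree's `B7.prop2_of_ineq53` on the level suprema over the boxes; the step is `dist1_plaqHol_avgFun_le_of_nested`.  Print: *«it is
enough to assume (52) for p ⊂ B^k(x) ∪ B^k(y) ∪ B^k(z) ∪ B^k(w)»* — here with the walk-hull margin `(d+4)L + 2` per level. [cite: Balaban1985Averaging, Prop. 2 (52)–(54) p.26] -/
theorem plaqSmallOn_iter_blockAvg_eml_loc (k : ℕ) {α₀ : ℝ} (hα : 0 < α₀)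
    (hα3 : (143 * ((((P.d + 4 : ℕ) : ℝ)) ^ 2 / 4) ^ 2) * α₀ ≤ 1 / 3)
    (hα2 : 2 * α₀ ≤ 2 * deltaSU n / (((P.d + 4) * P.L : ℕ) : ℝ) ^ 2)
    (xs : (i : ℕ) → Site P i) (hxs : ∀ i < k, xs i = emb (xs (i + 1)))
    (r : ℕ → ℕ) (hr : ∀ i < k, P.L * r (i + 1) + ((P.d + 4) * P.L + 2) ≤ r i)
    {U : GaugeField P 0 (Matrix.specialUnitaryGroup n ℂ)}
    (h52 : PlaqSmallOn (↑(boxRegion (xs 0) (r 0)) : Set (Plaq P 0)) (α₀ * (((P.L : ℝ) ^ k)⁻¹) ^ 2) U) :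
    PlaqSmallOn (↑(boxRegion (xs k) (r k)) : Set (Plaq P k)) (α₀ + 2 * (143 * ((((P.d + 4 : ℕ) : ℝ)) ^ 2 / 4) ^ 2) * α₀ ^ 2)
      (Averaging.iter (fun _ => blockAvg (expMeanLogSU (n := n))) k U) := by
  obtain ⟨a, ha0, hale, halt⟩ := exists_levelSupOn (fun i => Averaging.iter (fun _ => blockAvg (expMeanLogSU (n := n))) i U)
    (fun i => boxRegion (xs i) (r i))
  have hL : (2 : ℝ) ≤ P.L := by exact_mod_cast P.hL.2
  have hLpos : (0 : ℝ) < (P.L : ℝ) ^ k := by have := P.L_pos; positivity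
  have hC₀ : (0 : ℝ) < 143 * ((((P.d + 4 : ℕ) : ℝ)) ^ 2 / 4) ^ 2 := by positivity
  have hmain := B7.prop2_of_ineq53 (P.L : ℝ) (((P.L : ℝ) ^ k)⁻¹) α₀ (143 * ((((P.d + 4 : ℕ) : ℝ)) ^ 2 / 4) ^ 2)
    (2 * deltaSU n / (((P.d + 4) * P.L : ℕ) : ℝ) ^ 2) k a hL (inv_pos.mpr hLpos) (mul_inv_cancel₀ hLpos.ne') hC₀ hα hα3 hα2
    (halt 0 _ (by positivity) fun p hp => h52 p (Finset.mem_coe.mpr hp)) ?_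
  · exact fun p hp => (hale k p (Finset.mem_coe.mp hp)).trans_lt hmain
  intro i hi Q hQ hQc hai
  have hsm : ((((P.d + 4) * P.L : ℕ) : ℝ) ^ 2 / 4) * a i ≤ deltaSU n / 2 :=
    (mul_le_mul_of_nonneg_left (hai.le.trans hQc) (by positivity)).trans (smallness_of_le_c2' le_rfl)
  refine halt (i + 1) _ (by positivity) fun p hp => ?_
  have h1 := dist1_plaqHol_avgFun_le_of_nested (ha0 i) hsm (hxs i hi) (hr i hi) (hale i) hp
  refine (show dist1 (GaugeField.plaqHol (Averaging.iter (fun _ => blockAvg (expMeanLogSU (n := n))) (i + 1) U) p) ≤ _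
    from h1).trans_lt ?_
  have hL2 : (0 : ℝ) < (P.L : ℝ) ^ 2 := by have := P.L_pos; positivity
  have e1 : (P.L : ℝ) ^ 2 * a i < (P.L : ℝ) ^ 2 * Q := mul_lt_mul_of_pos_left hai hL2
  have e2 : ((P.L : ℝ) ^ 2 * a i) ^ 2 ≤ ((P.L : ℝ) ^ 2 * Q) ^ 2 := by
    have := ha0 i
    gcongr
  nlinarith [mul_le_mul_of_nonneg_left e2 hC₀.le]

/-- **ALL INTERMEDIATE LEVELS (53), LOCAL**: under the same hypotheses, for every `j ≤ k` every plaquette of `boxRegion (xs j) (r j)` satisfies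
`|Ū^j(∂p) − 1| < 2α₀(L^jη)²`, `η = L^{−k}` (`B7.ineq53_induction` BY NAME). [cite: Balaban1985Averaging, (53) p.26] -/
theorem plaqSmallOn_iter_blockAvg_eml_loc_level (k : ℕ) {α₀ : ℝ} (hα : 0 < α₀)
    (hα3 : (143 * ((((P.d + 4 : ℕ) : ℝ)) ^ 2 / 4) ^ 2) * α₀ ≤ 1 / 3)
    (hα2 : 2 * α₀ ≤ 2 * deltaSU n / (((P.d + 4) * P.L : ℕ) : ℝ) ^ 2)
    (xs : (i : ℕ) → Site P i) (hxs : ∀ i < k, xs i = emb (xs (i + 1)))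
    (r : ℕ → ℕ) (hr : ∀ i < k, P.L * r (i + 1) + ((P.d + 4) * P.L + 2) ≤ r i)
    {U : GaugeField P 0 (Matrix.specialUnitaryGroup n ℂ)}
    (h52 : PlaqSmallOn (↑(boxRegion (xs 0) (r 0)) : Set (Plaq P 0)) (α₀ * (((P.L : ℝ) ^ k)⁻¹) ^ 2) U)
    {j : ℕ} (hj : j ≤ k) :
    PlaqSmallOn (↑(boxRegion (xs j) (r j)) : Set (Plaq P j)) (2 * α₀ * ((P.L : ℝ) ^ j * ((P.L : ℝ) ^ k)⁻¹) ^ 2)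
      (Averaging.iter (fun _ => blockAvg (expMeanLogSU (n := n))) j U) := by
  obtain ⟨a, ha0, hale, halt⟩ := exists_levelSupOn (fun i => Averaging.iter (fun _ => blockAvg (expMeanLogSU (n := n))) i U)
    (fun i => boxRegion (xs i) (r i))
  have hL : (2 : ℝ) ≤ P.L := by exact_mod_cast P.hL.2
  have hLpos : (0 : ℝ) < (P.L : ℝ) ^ k := by have := P.L_pos; positivity
  have hC₀ : (0 : ℝ) < 143 * ((((P.d + 4 : ℕ) : ℝ)) ^ 2 / 4) ^ 2 := by positivity
  have hind := B7.ineq53_induction (P.L : ℝ) (((P.L : ℝ) ^ k)⁻¹) α₀ (143 * ((((P.d + 4 : ℕ) : ℝ)) ^ 2 / 4) ^ 2)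
    (2 * deltaSU n / (((P.d + 4) * P.L : ℕ) : ℝ) ^ 2) k a hL (inv_pos.mpr hLpos) (mul_inv_cancel₀ hLpos.ne').le hC₀ hα hα3 hα2
    (halt 0 _ (by positivity) fun p hp => h52 p (Finset.mem_coe.mpr hp)) ?_ j hj
  · intro p hp
    refine (hale j p (Finset.mem_coe.mp hp)).trans_lt (hind.trans_le ?_)
    set x : ℝ := ((P.L : ℝ) ^ j * ((P.L : ℝ) ^ k)⁻¹) ^ 2 with hx
    have hx0 : 0 ≤ x := by positivity
    have hx1 : x ≤ 1 := by
      rw [hx]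
      have hjk : (P.L : ℝ) ^ j * ((P.L : ℝ) ^ k)⁻¹ ≤ 1 := by
        rw [mul_inv_le_iff₀ hLpos, one_mul]
        exact pow_le_pow_right₀ (by linarith) hj
      have h0 : 0 ≤ (P.L : ℝ) ^ j * ((P.L : ℝ) ^ k)⁻¹ := by positivity
      nlinarith
    have hS := B7.geom_bracket_le_two _ (by positivity) (B7.prop2_ratio_lt_half _ α₀ (P.L : ℝ) hL (by positivity) hα3).le j
    have hCa : 0 ≤ 143 * ((((P.d + 4 : ℕ) : ℝ)) ^ 2 / 4) ^ 2 * (α₀ * x) ^ 2 := by positivity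
    calc α₀ * x + 143 * ((((P.d + 4 : ℕ) : ℝ)) ^ 2 / 4) ^ 2 * (α₀ * x) ^ 2 *
          ∑ i ∈ Finset.range j, ((1 + 143 * ((((P.d + 4 : ℕ) : ℝ)) ^ 2 / 4) ^ 2 * α₀) ^ 2 / (P.L : ℝ) ^ 2) ^ i
        ≤ α₀ * x + 143 * ((((P.d + 4 : ℕ) : ℝ)) ^ 2 / 4) ^ 2 * (α₀ * x) ^ 2 * 2 := by gcongr
      _ ≤ 2 * α₀ * x := by
          have hx2 : x * x ≤ x := by nlinarith
          have hαx : 0 ≤ α₀ * x := mul_nonneg hα.le hx0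
          have h1 : (α₀ * x) ^ 2 ≤ (α₀ * x) * α₀ := by
            rw [show (α₀ * x) ^ 2 = α₀ * α₀ * (x * x) by ring, show α₀ * x * α₀ = α₀ * α₀ * x by ring]
            exact mul_le_mul_of_nonneg_left hx2 (by positivity)
          have h2 : 143 * ((((P.d + 4 : ℕ) : ℝ)) ^ 2 / 4) ^ 2 * (α₀ * x) ^ 2 * 2 ≤
              143 * ((((P.d + 4 : ℕ) : ℝ)) ^ 2 / 4) ^ 2 * ((α₀ * x) * α₀) * 2 := by gcongr
          have h3 : 143 * ((((P.d + 4 : ℕ) : ℝ)) ^ 2 / 4) ^ 2 * ((α₀ * x) * α₀) * 2 =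
              (143 * ((((P.d + 4 : ℕ) : ℝ)) ^ 2 / 4) ^ 2 * α₀) * (α₀ * x) * 2 := by ring
          rw [h3] at h2
          have h4 : (143 * ((((P.d + 4 : ℕ) : ℝ)) ^ 2 / 4) ^ 2 * α₀) * (α₀ * x) * 2 ≤ (1 / 3) * (α₀ * x) * 2 := by gcongr
          linarith
  intro i hi Q hQ hQc hai
  have hsm : ((((P.d + 4) * P.L : ℕ) : ℝ) ^ 2 / 4) * a i ≤ deltaSU n / 2 :=
    (mul_le_mul_of_nonneg_left (hai.le.trans hQc) (by positivity)).trans (smallness_of_le_c2' le_rfl)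
  refine halt (i + 1) _ (by positivity) fun p hp => ?_
  have h1 := dist1_plaqHol_avgFun_le_of_nested (ha0 i) hsm (hxs i hi) (hr i hi) (hale i) hp
  refine (show dist1 (GaugeField.plaqHol (Averaging.iter (fun _ => blockAvg (expMeanLogSU (n := n))) (i + 1) U) p) ≤ _
    from h1).trans_lt ?_
  have hL2 : (0 : ℝ) < (P.L : ℝ) ^ 2 := by have := P.L_pos; positivity
  have e1 : (P.L : ℝ) ^ 2 * a i < (P.L : ℝ) ^ 2 * Q := mul_lt_mul_of_pos_left hai hL2
  have e2 : ((P.L : ℝ) ^ 2 * a i) ^ 2 ≤ ((P.L : ℝ) ^ 2 * Q) ^ 2 := by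
    have := ha0 i
    gcongr
  nlinarith [mul_le_mul_of_nonneg_left e2 hC₀.le]

/-- **THE CLOSED-FORM RADII** `r(i) = L^{k−i}·(m + c) − c`, `c = (d+4)L + 2`, satisfy the nesting condition `L·r(i+1) + c ≤ r(i)` (`L ≥ 2`), start at
`r(0) = L^k(m + c) − c ≤ L^k(m + c)` and end at `r(k) = m`. [folklore] -/
theorem nested_radii_pow (k m : ℕ) :
    (∀ i < k, P.L * (P.L ^ (k - (i + 1)) * (m + ((P.d + 4) * P.L + 2)) - ((P.d + 4) * P.L + 2)) + ((P.d + 4) * P.L + 2) ≤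
        P.L ^ (k - i) * (m + ((P.d + 4) * P.L + 2)) - ((P.d + 4) * P.L + 2)) ∧
      P.L ^ (k - k) * (m + ((P.d + 4) * P.L + 2)) - ((P.d + 4) * P.L + 2) = m ∧
      P.L ^ (k - 0) * (m + ((P.d + 4) * P.L + 2)) - ((P.d + 4) * P.L + 2) ≤ P.L ^ k * (m + ((P.d + 4) * P.L + 2)) := by
  set c : ℕ := (P.d + 4) * P.L + 2 with hc
  have hL : 2 ≤ P.L := P.hL.2
  refine ⟨fun i hi => ?_, by simp, by simp⟩
  set A : ℕ := P.L ^ (k - (i + 1)) * (m + c) with hA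
  have hki : k - i = (k - (i + 1)) + 1 := by omega
  have hLA : P.L ^ (k - i) * (m + c) = P.L * A := by rw [hki, pow_succ, hA]; ring
  rw [hLA]
  have hA1 : c ≤ A := by
    rw [hA]
    calc c ≤ m + c := Nat.le_add_left _ _
      _ = 1 * (m + c) := (one_mul _).symm
      _ ≤ P.L ^ (k - (i + 1)) * (m + c) := Nat.mul_le_mul_right _ (Nat.one_le_pow _ _ P.L_pos)
  have h1 : P.L * (A - c) = P.L * A - P.L * c := Nat.mul_sub P.L A c
  have h2 : 2 * c ≤ P.L * c := Nat.mul_le_mul_right c hL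
  have h3 : P.L * c ≤ P.L * A := Nat.mul_le_mul_left _ hA1
  rw [h1]
  omega

/-- **PROPOSITION 2 LOCAL, CLOSED-FORM RADII**: (52) on the fine box of radius `L^k·(m + (d+4)L + 2)` around the bottom `xs 0` of a chain of block
centres implies (54) on `boxRegion (xs k) m`. [cite: Balaban1985Averaging, Prop. 2 (52)–(54) p.26] -/
theorem plaqSmallOn_iter_blockAvg_eml_loc_pow (k : ℕ) {α₀ : ℝ} (hα : 0 < α₀)
    (hα3 : (143 * ((((P.d + 4 : ℕ) : ℝ)) ^ 2 / 4) ^ 2) * α₀ ≤ 1 / 3)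
    (hα2 : 2 * α₀ ≤ 2 * deltaSU n / (((P.d + 4) * P.L : ℕ) : ℝ) ^ 2)
    (xs : (i : ℕ) → Site P i) (hxs : ∀ i < k, xs i = emb (xs (i + 1))) (m : ℕ)
    {U : GaugeField P 0 (Matrix.specialUnitaryGroup n ℂ)}
    (h52 : PlaqSmallOn (↑(boxRegion (xs 0) (P.L ^ k * (m + ((P.d + 4) * P.L + 2)))) : Set (Plaq P 0)) (α₀ * (((P.L : ℝ) ^ k)⁻¹) ^ 2) U) :
    PlaqSmallOn (↑(boxRegion (xs k) m) : Set (Plaq P k)) (α₀ + 2 * (143 * ((((P.d + 4 : ℕ) : ℝ)) ^ 2 / 4) ^ 2) * α₀ ^ 2)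
      (Averaging.iter (fun _ => blockAvg (expMeanLogSU (n := n))) k U) := by
  obtain ⟨hr, hrk, hr0⟩ := nested_radii_pow (P := P) k m
  have h := plaqSmallOn_iter_blockAvg_eml_loc k hα hα3 hα2 xs hxs
    (fun i => P.L ^ (k - i) * (m + ((P.d + 4) * P.L + 2)) - ((P.d + 4) * P.L + 2)) hr
    (U := U) fun p hp => h52 p (Finset.mem_coe.mpr (boxRegion_mono _ hr0 (Finset.mem_coe.mp hp)))
  rw [hrk] at h
  exact h

end Prop2

/-! ## §3 At NODE 00: the END's γ3 reading `hcore` in box-local form at ₈a's minimiser of record -/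

section Node00

open Literature.MathematicalPhysics.QuantumFieldTheory.Balaban1983to89.T4Continuum (T4Family)
open Literature.MathematicalPhysics.QuantumFieldTheory.Balaban1983to89.Node00

variable {F : T4Family} {N : ℕ} [NeZero N]

/-- **[Balaban1985Averaging] PROP. 2 LOCAL AT NODE 00's AVERAGING OF RECORD** (`avOfRecord F N K = blockAvg expMeanLogSU`, `η_k = Params.eta k`):
(52) with `α₀η_k²` on the fine box of radius `L^k(m + (d+4)L + 2)` around `xs 0` ⇒ `|Ū^k(∂p) − 1| < 2α₀` on `boxRegion (xs k) m`.
[cite: Balaban1985Averaging, Prop. 2 (52)–(54) p.26] -/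
theorem plaqSmallOn_iter_avOfRecord_loc (K k : ℕ) {α₀ : ℝ} (hα : 0 < α₀)
    (hα3 : (143 * (((((F.P K).d + 4 : ℕ) : ℝ)) ^ 2 / 4) ^ 2) * α₀ ≤ 1 / 3)
    (hα2 : 2 * α₀ ≤ 2 * deltaSU (Fin N) / ((((F.P K).d + 4) * (F.P K).L : ℕ) : ℝ) ^ 2)
    (xs : (i : ℕ) → Site (F.P K) i) (hxs : ∀ i < k, xs i = emb (xs (i + 1))) (m : ℕ)
    {U : GaugeField (F.P K) 0 (SU N)}
    (h52 : PlaqSmallOn (↑(boxRegion (xs 0) ((F.P K).L ^ k * (m + (((F.P K).d + 4) * (F.P K).L + 2)))) : Set (Plaq (F.P K) 0))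
      (α₀ * (F.P K).eta k ^ 2) U) :
    PlaqSmallOn (↑(boxRegion (xs k) m) : Set (Plaq (F.P K) k)) (2 * α₀) (Averaging.iter (avOfRecord F N K) k U) := by
  have h52' : PlaqSmallOn (↑(boxRegion (xs 0) ((F.P K).L ^ k * (m + (((F.P K).d + 4) * (F.P K).L + 2)))) : Set (Plaq (F.P K) 0))
      (α₀ * ((((F.P K).L : ℝ) ^ k)⁻¹) ^ 2) U := by
    intro p hp; have := h52 p hp; rwa [Params.eta, inv_pow] at this
  have h := plaqSmallOn_iter_blockAvg_eml_loc_pow (n := Fin N) k hα hα3 hα2 xs hxs m h52'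
  intro p hp
  exact (h p hp).trans (B7.prop2_bound_lt_two_alpha _ α₀ hα hα3)

/-- **THE γ3 READING `hcore` OF THE ONE-CALL END AT ₈a's MINIMISER, BOX-LOCAL FORM**: on the solvable set (`UkExists`), if the background of record
`U_k(V) = Node00.Uk F N K k ε V` is `θη_k²`-plaquette-small ON THE FINE BOX of radius `L^k(m + (d+4)L + 2)` around the bottom `xs 0` of a chain of block
centres below `x = xs k` (an admissible `θ`, e.g. the slot's lowered threshold), then the datum `V` is `2θ`-plaquette-small ON `boxRegion x m` — «slot
variable `< θη_k²` near the box ⇒ datum `2θ`-small on the box», with `Ū^k(U_k(V)) = V` (`Node00.iter_Uk`); the local species of generation 2's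
`N21AveragedDatumRegularity.plaqSmall_datum_of_Uk_plaqSmall`. [cite: Balaban1985Averaging, Prop. 2 (52)–(54) p.26] -/
theorem plaqSmallOn_datum_of_Uk_plaqSmallOn (K k : ℕ) {ε θ : ℝ} (hθ : 0 < θ)
    (hθ3 : (143 * (((((F.P K).d + 4 : ℕ) : ℝ)) ^ 2 / 4) ^ 2) * θ ≤ 1 / 3)
    (hθ2 : 2 * θ ≤ 2 * deltaSU (Fin N) / ((((F.P K).d + 4) * (F.P K).L : ℕ) : ℝ) ^ 2)
    (xs : (i : ℕ) → Site (F.P K) i) (hxs : ∀ i < k, xs i = emb (xs (i + 1))) (m : ℕ)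
    {V : GaugeField (F.P K) k (SU N)} (h : UkExists F N K k ε V)
    (hu : PlaqSmallOn (↑(boxRegion (xs 0) ((F.P K).L ^ k * (m + (((F.P K).d + 4) * (F.P K).L + 2)))) : Set (Plaq (F.P K) 0))
      (θ * (F.P K).eta k ^ 2) (Uk F N K k ε V)) :
    PlaqSmallOn (↑(boxRegion (xs k) m) : Set (Plaq (F.P K) k)) (2 * θ) V := by
  have key := plaqSmallOn_iter_avOfRecord_loc K k hθ hθ3 hθ2 xs hxs m hu
  rwa [iter_Uk h] at key

/-- **ANY MINIMISER OF (0.21) WITH A LOCALLY REGULAR BACKGROUND HAS A LOCALLY REGULAR DATUM**: if `U₀` minimises along `avOfRecord` with `Ū₀^k = V`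
(`Setup.IsBackground`, any class) and `U₀` is `θη_k²`-small on the fine box of radius `L^k(m + (d+4)L + 2)` around `xs 0`, then `V` is `2θ`-small on
`boxRegion (xs k) m`. [cite: Balaban1985Averaging, Prop. 2 (52)–(54) p.26] -/
theorem plaqSmallOn_datum_of_isBackground_loc (K k : ℕ) {θ : ℝ} (hθ : 0 < θ)
    (hθ3 : (143 * (((((F.P K).d + 4 : ℕ) : ℝ)) ^ 2 / 4) ^ 2) * θ ≤ 1 / 3)
    (hθ2 : 2 * θ ≤ 2 * deltaSU (Fin N) / ((((F.P K).d + 4) * (F.P K).L : ℕ) : ℝ) ^ 2)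
    (xs : (i : ℕ) → Site (F.P K) i) (hxs : ∀ i < k, xs i = emb (xs (i + 1))) (m : ℕ)
    {C : Set (GaugeField (F.P K) 0 (SU N))} {V : GaugeField (F.P K) k (SU N)} {U₀ : GaugeField (F.P K) 0 (SU N)}
    (hU₀ : IsBackground (avOfRecord F N K) C k V U₀)
    (hu : PlaqSmallOn (↑(boxRegion (xs 0) ((F.P K).L ^ k * (m + (((F.P K).d + 4) * (F.P K).L + 2)))) : Set (Plaq (F.P K) 0))
      (θ * (F.P K).eta k ^ 2) U₀) :
    PlaqSmallOn (↑(boxRegion (xs k) m) : Set (Plaq (F.P K) k)) (2 * θ) V := by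
  have key := plaqSmallOn_iter_avOfRecord_loc K k hθ hθ3 hθ2 xs hxs m hu
  rwa [hU₀.1] at key

end Node00

end Summit.QuantumFields.YangMills.Theorems.N21LocalAveragedRegularity

end
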